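import Mathlib
import Literature.MathematicalPhysics.QuantumFieldTheory.Balaban1983to89.T3YM3TorusStatement
import Literature.MathematicalPhysics.QuantumFieldTheory.Balaban1983to89.T3NestedUnitLaws
import Literature.MathematicalPhysics.QuantumFieldTheory.Balaban1983to89.T3UnitLawDensityEML
import Literature.MathematicalPhysics.QuantumFieldTheory.Balaban1983to89.BalabanUVClass
import Literature.MathematicalPhysics.QuantumFieldTheory.Balaban1983to89.T3UnitScaleTilt
import Literature.MathematicalPhysics.QuantumFieldTheory.Balaban1983to89.T3Thresholds
import Literature.MathematicalPhysics.QuantumFieldTheory.Balaban1983to89.T3ThresholdSmallness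
import Literature.MathematicalPhysics.QuantumFieldTheory.Balaban1983to89.T3MinimiserStabilityReduction
import Literature.MathematicalPhysics.QuantumFieldTheory.Balaban1983to89.TorusGeometry
import Literature.MathematicalPhysics.QuantumFieldTheory.Balaban1983to89.B10StarCount

/-!
# Route `BackwardLiouvilleRigidity`, support `FlatRatioTermination` (stmt-QuantumFields-22542) — registered stub `stub_thresholds`

The NUMERIC stub of planner ym-r3-idea-1 g10's re-cut skeleton (sha 6f6fdb21): with `θ_j = θBal L γ b₀ p₀ j = g_j p(g_j)`,
`θin_j = θBal L γ (√b₀) (p₀/2) j = g_j √(p(g_j))` (`g_j = √(γ L^{-j})`, `p(g) = b₀ (1 + log g⁻¹)^{p₀}`) and `η_j = √θ_j / 16`, for `p₀ ≥ 1`,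
every family, `γ ∈ (0,1]`, `b₀ > 0`, FROM SOME HEIGHT ON: `0 < η_j ≤ 1/4`, `θin_j + 32 η_j² < θ_j` (i.e. `√(p(g_j)) > 8/7`) and
`1/η_j² + 2/η_j + 4 ≤ #PBond_j = 3·(2L^{m+j})³`.  All four because `g_j → 0⁺`: `θ_j → 0` (`T3ThresholdSmallness.tendsto_θBal_atTop`),
`p(g_j) → ∞`, and `θ_j · L^{3(m+j)} ≥ b₀ g_j L^{3j} → ∞`.

HONEST SCOPE.  Elementary asymptotics; nothing about the global-gauge stub, the crux `ClassLimitTrajectories`, rung R3 or any summit; nothing here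
bears on the Yang–Mills mass gap.
-/

namespace Summit.QuantumFields.YangMills.Theorems.FlatRatioTermination

open Filter Topology
open Literature.MathematicalPhysics.QuantumFieldTheory.Balaban1983to89
open Literature.MathematicalPhysics.QuantumFieldTheory.Balaban1983to89.T3ContinuumYM3Torus
open Literature.MathematicalPhysics.QuantumFieldTheory.Balaban1983to89.T3UnitScaleTilt

/-- The number of positively oriented bonds of the finest lattice of the `j`-th approximation: `3·(2L^{m+j})³`. [cite: Balaban1985UV3, (1)-(3) p.256] -/
theorem card_pbond_T3 (F : T3Family) (j : ℕ) :
    (Fintype.card (PBond (F.P j) 0) : ℝ) = 3 * (2 * (F.L : ℝ) ^ (F.m + j)) ^ 3 := by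
  have h1 : Fintype.card (PBond (F.P j) 0) = (F.P j).d * Fintype.card (Site (F.P j) 0) := B10StarCount.card_pbond
  have h2 : Fintype.card (Site (F.P j) 0) = (F.P j).sitesPerDir 0 ^ (F.P j).d := Site.card_site _ _
  have h3 : (F.P j).sitesPerDir 0 = 2 * F.L ^ (F.m + j) := rfl
  have hd : (F.P j).d = 3 := rfl
  rw [h1, h2, h3, hd]
  push_cast
  ring
set_option maxHeartbeats 400000 in
/-- **REGISTERED STUB `stub_thresholds`** of the skeleton for `FlatRatioTermination` (stmt-QuantumFields-22542), verbatim: the four numeric side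
conditions of the chain lemma hold from some height on (`pW = 1`). [cite: Balaban1985UV3, (3) p.256 and (7) p.257] -/
theorem stub_thresholds : open MeasureTheory Filter Topology Literature.MathematicalPhysics.QuantumFieldTheory.Balaban1983to89 T3ContinuumYM3Torus T3NestedUnitLaws T3UnitLawDensityEML T4Continuum BalabanUVClass T3UnitScaleTilt in ∃ pW : ℝ, ∀ (p₀ : ℝ), pW ≤ p₀ → ∀ (F : T3Family) (γ b₀ : ℝ), 0 < γ → γ ≤ 1 → 0 < b₀ → ∃ jW : ℕ, ∀ j : ℕ, jW ≤ j → 0 < Real.sqrt (θBal F.L γ b₀ p₀ j) / 16 ∧ Real.sqrt (θBal F.L γ b₀ p₀ j) / 16 ≤ 1 / 4 ∧ θBal F.L γ (Real.sqrt b₀) (p₀ / 2) j + 32 * (Real.sqrt (θBal F.L γ b₀ p₀ j) / 16) ^ 2 < θBal F.L γ b₀ p₀ j ∧ 1 / (Real.sqrt (θBal F.L γ b₀ p₀ j) / 16) ^ 2 + 2 / (Real.sqrt (θBal F.L γ b₀ p₀ j) / 16) + 4 ≤ (Fintype.card (PBond (F.P j) 0) : ℝ) := by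
  refine ⟨1, ?_⟩
  intro p₀ hp₀ F γ b₀ hγ hγ1 hb₀
  have hL1 : 1 < F.L := F.hL.2
  have hL1' : 1 ≤ F.L := hL1.le
  have hLR : (1 : ℝ) < F.L := by exact_mod_cast hL1
  have hLpos : (0 : ℝ) < F.L := by linarith
  -- the couplings `g_j`, the logarithms `x_j = 1 + log g_j⁻¹`, the thresholds
  set g : ℕ → ℝ := fun j => Real.sqrt (γ * ((F.L : ℝ)⁻¹) ^ j) with hgdef
  have hg : ∀ j, 0 < g j ∧ g j ≤ 1 := fun j =>
    ⟨(T3ThresholdSmallness.sqrt_coupling_pos_le hL1' hγ j).1, T3Thresholds.coupling_le_one hL1' hγ hγ1 j⟩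
  set x : ℕ → ℝ := fun j => 1 + Real.log (g j)⁻¹ with hxdef
  have hx1 : ∀ j, 1 ≤ x j := fun j => by
    have : 0 ≤ Real.log (g j)⁻¹ := Real.log_nonneg (one_le_inv_iff₀.mpr ⟨(hg j).1, (hg j).2⟩)
    simp only [hxdef]; linarith
  have hθ : ∀ j, θBal F.L γ b₀ p₀ j = g j * (b₀ * x j ^ p₀) := fun j => rfl
  have hsb : 0 < Real.sqrt b₀ := Real.sqrt_pos.mpr hb₀
  have hθin : ∀ j, θBal F.L γ (Real.sqrt b₀) (p₀ / 2) j = g j * (Real.sqrt b₀ * x j ^ (p₀ / 2)) := fun j => rfl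
  have hxsq : ∀ j, x j ^ p₀ = x j ^ (p₀ / 2) * x j ^ (p₀ / 2) := fun j => by
    rw [← Real.rpow_add (by linarith [hx1 j])]; ring_nf
  have hθpos : ∀ j, 0 < θBal F.L γ b₀ p₀ j := fun j => T3MinimiserStabilityReduction.θBal_pos hL1' hγ hγ1 hb₀ _ _
  -- (E1) `θ_j < 16` eventually
  have E1 : ∀ᶠ j in atTop, θBal F.L γ b₀ p₀ j < 16 :=
    (tendsto_order.1 (T3ThresholdSmallness.tendsto_θBal_atTop hL1 hγ b₀ p₀)).2 16 (by norm_num)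
  -- `g_j → 0⁺`, so `x_j → ∞` and `x_j^{p₀/2} → ∞`
  have hg0 : Tendsto g atTop (𝓝 0) := by
    have hpow : Tendsto (fun i : ℕ => γ * ((F.L : ℝ)⁻¹) ^ i) atTop (𝓝 0) := by
      have h := (tendsto_pow_atTop_nhds_zero_of_lt_one (inv_nonneg.mpr hLpos.le) (inv_lt_one_of_one_lt₀ hLR)).const_mul γ
      rw [mul_zero] at h; exact h
    have h := (Real.continuous_sqrt.tendsto 0).comp hpow
    rw [Real.sqrt_zero] at h
    exact h
  have hginv : Tendsto (fun j => (g j)⁻¹) atTop atTop :=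
    tendsto_inv_nhdsGT_zero.comp (tendsto_nhdsWithin_iff.mpr ⟨hg0, Eventually.of_forall fun j => (hg j).1⟩)
  have hxT : Tendsto x atTop atTop := by
    simp only [hxdef]
    exact tendsto_atTop_add_const_left _ 1 (Real.tendsto_log_atTop.comp hginv)
  have hsT : Tendsto (fun j => x j ^ (p₀ / 2)) atTop atTop := (tendsto_rpow_atTop (by linarith)).comp hxT
  -- (E2) `8/(7√b₀) < x_j^{p₀/2}` eventually
  have E2 : ∀ᶠ j in atTop, 8 / (7 * Real.sqrt b₀) < x j ^ (p₀ / 2) := hsT.eventually_gt_atTop _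
  -- (E3) `32 ≤ b₀ · g_j · L^{3(m+j)}` eventually: since `(g_j L^{3(m+j)})² = γ L^{6m+5j} ≥ γ L^j → ∞`
  have hLj : Tendsto (fun j : ℕ => γ * (F.L : ℝ) ^ j) atTop atTop :=
    Tendsto.const_mul_atTop hγ (tendsto_pow_atTop_atTop_of_one_lt hLR)
  have E3 : ∀ᶠ j in atTop, (32 / b₀) ^ 2 ≤ γ * (F.L : ℝ) ^ j := hLj.eventually_ge_atTop _
  obtain ⟨jW, hjW⟩ := eventually_atTop.mp (E1.and (E2.and E3))
  refine ⟨jW, fun j hj => ?_⟩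
  obtain ⟨e1, e2, e3⟩ := hjW j hj
  set θ := θBal F.L γ b₀ p₀ j with hθdef
  have hθp : 0 < θ := hθpos j
  have hsθ : 0 < Real.sqrt θ := Real.sqrt_pos.mpr hθp
  have hsq : (Real.sqrt θ / 16) ^ 2 = θ / 256 := by rw [div_pow, Real.sq_sqrt hθp.le]; norm_num
  refine ⟨by positivity, ?_, ?_, ?_⟩
  · -- `√θ/16 ≤ 1/4`
    have : Real.sqrt θ ≤ 4 := by
      rw [show (4 : ℝ) = Real.sqrt 16 by rw [show (16 : ℝ) = 4 ^ 2 by norm_num, Real.sqrt_sq (by norm_num)]]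
      exact Real.sqrt_le_sqrt e1.le
    linarith
  · -- `θin + θ/8 < θ`
    rw [hsq, hθin j, hθdef, hθ j, hxsq j]
    have hgj := (hg j).1
    have hs : 0 < x j ^ (p₀ / 2) := Real.rpow_pos_of_pos (by linarith [hx1 j]) _
    have h8 : 8 < 7 * Real.sqrt b₀ * x j ^ (p₀ / 2) := by
      have := (div_lt_iff₀ (by positivity : (0 : ℝ) < 7 * Real.sqrt b₀)).mp e2
      linarith
    have h2 : Real.sqrt b₀ * Real.sqrt b₀ = b₀ := Real.mul_self_sqrt hb₀.le
    have hkey : Real.sqrt b₀ < 7 / 8 * b₀ * x j ^ (p₀ / 2) := by nlinarith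
    have hmul := mul_lt_mul_of_pos_left hkey (mul_pos hgj hs)
    linarith
  · -- the count
    rw [hsq, card_pbond_T3]
    have hLmj : (1 : ℝ) ≤ (F.L : ℝ) ^ (F.m + j) := one_le_pow₀ hLR.le
    set N : ℝ := (F.L : ℝ) ^ (F.m + j) with hN
    have hNpos : 0 < N := by positivity
    -- `θ · (2N)³ ≥ 256`: `θ ≥ b₀ g_j` and `(b₀ g_j N³)² = b₀² γ L^{-j} L^{6(m+j)} ≥ b₀² γ L^j ≥ 32²`
    have hθlow : b₀ * g j ≤ θ := by
      have h1 : θ = g j * (b₀ * x j ^ p₀) := by rw [hθdef, hθ j]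
      have h2 : 1 ≤ x j ^ p₀ := Real.one_le_rpow (hx1 j) (by linarith)
      have h3 : g j * (b₀ * 1) ≤ g j * (b₀ * x j ^ p₀) :=
        mul_le_mul_of_nonneg_left (mul_le_mul_of_nonneg_left h2 hb₀.le) (hg j).1.le
      rw [h1]; linarith
    have hgN : 32 ≤ b₀ * g j * N ^ 3 := by
      have hsqg : g j ^ 2 = γ * ((F.L : ℝ)⁻¹) ^ j := by rw [hgdef]; exact Real.sq_sqrt (by positivity)
      have hN3 : N ^ 3 = (F.L : ℝ) ^ j * ((F.L : ℝ) ^ (3 * F.m + 2 * j)) := by rw [hN, ← pow_mul, ← pow_add]; ring_nf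
      have hsq2 : (b₀ * g j * N ^ 3) ^ 2 = b₀ ^ 2 * (γ * (F.L : ℝ) ^ j) * ((F.L : ℝ) ^ (3 * F.m + 2 * j)) ^ 2 * 1 := by
        rw [mul_pow, mul_pow, hsqg, hN3, inv_pow]
        field_simp
      have hbig : (32 : ℝ) ^ 2 ≤ (b₀ * g j * N ^ 3) ^ 2 := by
        rw [hsq2]
        have h1 : (32 : ℝ) ^ 2 = b₀ ^ 2 * (32 / b₀) ^ 2 := by field_simp
        have h2 : (1 : ℝ) ≤ ((F.L : ℝ) ^ (3 * F.m + 2 * j)) ^ 2 := one_le_pow₀ (one_le_pow₀ hLR.le)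
        rw [h1]
        have h3 : b₀ ^ 2 * (32 / b₀) ^ 2 ≤ b₀ ^ 2 * (γ * (F.L : ℝ) ^ j) := mul_le_mul_of_nonneg_left e3 (by positivity)
        nlinarith [mul_le_mul_of_nonneg_left h2 (by positivity : (0 : ℝ) ≤ b₀ ^ 2 * (γ * (F.L : ℝ) ^ j))]
      nlinarith [sq_nonneg (b₀ * g j * N ^ 3 - 32), sq_nonneg (b₀ * g j * N ^ 3 + 32),
        mul_pos (mul_pos hb₀ (hg j).1) (pow_pos hNpos 3)]
    have hθN : 32 ≤ θ * N ^ 3 := le_trans hgN (by nlinarith [pow_pos hNpos 3])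
    -- the three terms
    have t1 : 1 / (θ / 256) ≤ 8 * N ^ 3 := by
      rw [one_div_div, div_le_iff₀ hθp]; nlinarith
    have t2 : 2 / (Real.sqrt θ / 16) ≤ 8 * N ^ 3 := by
      rw [div_div_eq_mul_div, div_le_iff₀ hsθ]
      -- `32 ≤ 8 N³ √θ` ⟸ `16 ≤ N⁶ θ · 4`... square: `(N³√θ)² = N⁶ θ ≥ 32 N³ ≥ 16`
      have hprod : 4 ≤ N ^ 3 * Real.sqrt θ := by
        have hsq' : (N ^ 3 * Real.sqrt θ) ^ 2 = N ^ 3 * (θ * N ^ 3) := by rw [mul_pow, Real.sq_sqrt hθp.le]; ring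
        have h16 : (4 : ℝ) ^ 2 ≤ (N ^ 3 * Real.sqrt θ) ^ 2 := by
          rw [hsq']
          have : (1 : ℝ) ≤ N ^ 3 := one_le_pow₀ hLmj
          nlinarith
        nlinarith [sq_nonneg (N ^ 3 * Real.sqrt θ - 4), sq_nonneg (N ^ 3 * Real.sqrt θ + 4),
          mul_pos (pow_pos hNpos 3) hsθ]
      nlinarith
    have t3 : (4 : ℝ) ≤ 8 * N ^ 3 := by nlinarith [one_le_pow₀ (n := 3) hLmj]
    nlinarith

end Summit.QuantumFields.YangMills.Theorems.FlatRatioTermination
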